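import Summits.HodgeConjecture.HodgeConjecture.Theorems.PadicSemiregularLiftHodgeFermatVarietiesPairedOfLargePrimesSharp
import Summits.HodgeConjecture.HodgeConjecture.Theorems.PadicSemiregularLiftHodgeFermatVarietiesFibreOfBoundaryNat
import HarnessLib

/-!
# Aoki's Theorem A one prime down: the level analysis for Hodge `(p+1)`-tuples at levels with least prime `p` — line `cancel-by-any-claim-lattice`, crux `HodgeFermatVarieties` (stmt-HodgeConjecture-1334)

Lead c4's programme GP (every prime `p ≥ 5` at once), stub GP-L2a `stub_fibre_of_top_level_general`. Setting: a prime
`p₁ ≥ 5`, a Hodge character `α : Fin R → ℤ/m` of length `R = p₁ + 1` (the Hodge characters of the Fermat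
`(p₁-1)`-fold), a level `m` all of whose prime factors are `≥ p₁`, with `p₁² ∤ m` and `p₁(p₁+2) ∤ m` (the two excluded
cores), and a level `M ∣ m` whose unit-part multiplicity function `cnt_M` is not even while `cnt_{M'}` is even at
every proper multiple `M'` of `M`. THEOREM: `M = p₁ n` with `p₁ ∤ n`, `n > 1`, and a full fibre
`{crt⁻¹(y, b) : y ∈ (ℤ/p₁)ˣ}` consists of unit parts of level-`M` entries of `α`.

For `p₁ = 5` this is `…FibreOfTopLevel` (sextuples), for `p₁ = 7` it is `…FibreOfTopLevelEight` (octuples); the proof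
is uniform in `R`: Aoki's criterion at conductor `M` plus the evenness above `M` make `T = cnt_M` orthogonal to the odd
primitive characters mod `M` (`sum_level_eq_zero_of_criterion`); as `T` is not even, the refined counting
`even_of_oddNull'` leaves a prime `p ∣ M` with `p ≤ #supp T + 1 ≤ p₁ + 2`, so `p = p₁` or `p` is the twin `p₁ + 2`.
The twin (all `R` entries distinct units at level `M = (p₁+2) n'`, `p₁ ∤ M` by the excluded twin core, `(p₁+2)² ∤ M` by
the failed clause) is the boundary case of `level_count_even_sharp` and dies by `even_or_fibre_of_boundary` plus the
kill `exists_odd_isPrimitive_apply_natCast_ne_one` (the primes of `n'` are `≥ p₁ + 4`); `p = p₁` gives `M = p₁ n`,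
`p₁ ∤ n`, primes of `n` `≥ p₁ + 3 > #supp T + 1`, and the ℕ-valued dichotomy `stub_fibre_of_boundary_nat` yields the
fibre (evenness being excluded).

References: [Aoki1983] N. Aoki, Math. Ann. 266 (1983) 23–54, Thm. A′ (§7), Prop. 2.2, Prop. 6.1, Prop. 6.4.
-/

-- every sibling file of the line declares into `…CancelByAnyClaimLattice.PairedNull` from a differently named module
set_option linter.dupNamespace false

noncomputable section

open Finset
open Literature.AlgebraicGeometry.HodgeTheory Literature.AlgebraicGeometry.HodgeTheory.FermatCharacter

namespace Summit.HodgeConjecture.HodgeConjecture.Theorems.CancelByAnyClaimLattice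

namespace PairedNull

section TopLevelGeneral

variable {m : ℕ} [NeZero m] {R : ℕ} {α : Fin R → ZMod m}

/-- **The level analysis of the programme GP** (section-variable form; see the module docstring). [cite: Aoki1983, Thm. A′ (§7), Prop. 2.2, Prop. 6.4] -/
theorem fibre_of_top_level_general {p₁ : ℕ} (hp₁ : p₁.Prime) (hp₁5 : 5 ≤ p₁) (hRp : R = p₁ + 1)
    (hmin : ∀ q ∈ m.primeFactors, p₁ ≤ q) (hsq : ¬ p₁ * p₁ ∣ m) (htwin : ¬ p₁ * (p₁ + 2) ∣ m) (h : IsHodge α)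
    {M : ℕ} (hMm : M ∣ m)
    (hne : ∃ v : ZMod M,
      #(univ.filter fun i : Fin R ↦ m / m.gcd (α i).val = M ∧ ((((α i).val / (m / M)) : ℕ) : ZMod M) = -v) ≠
      #(univ.filter fun i : Fin R ↦ m / m.gcd (α i).val = M ∧ ((((α i).val / (m / M)) : ℕ) : ZMod M) = v))
    (hIH : ∀ M' : ℕ, M' ∣ m → M ∣ M' → M' ≠ M → ∀ u : ZMod M',
      #(univ.filter fun i : Fin R ↦ m / m.gcd (α i).val = M' ∧ ((((α i).val / (m / M')) : ℕ) : ZMod M') = -u) =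
      #(univ.filter fun i : Fin R ↦ m / m.gcd (α i).val = M' ∧ ((((α i).val / (m / M')) : ℕ) : ZMod M') = u)) :
    ∃ (n : ℕ) (hc : Nat.Coprime p₁ n), M = p₁ * n ∧ 1 < n ∧ ∃ b : ZMod n, IsUnit b ∧
      ∀ y : (ZMod p₁)ˣ, ∃ i : Fin R, m / m.gcd (α i).val = p₁ * n ∧
        ((((α i).val / (m / (p₁ * n))) : ℕ) : ZMod (p₁ * n)) = (ZMod.chineseRemainder hc).symm ((y : ZMod p₁), b) := by
  classical
  haveI : NeZero p₁ := ⟨hp₁.ne_zero⟩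
  have hm0 : m ≠ 0 := NeZero.ne m
  have hM0 : M ≠ 0 := fun h0 ↦ hm0 (by rw [h0] at hMm; exact zero_dvd_iff.mp hMm)
  haveI : NeZero M := ⟨hM0⟩
  have hp₁2 : p₁ ≠ 2 := by omega
  have hp₁odd : Odd p₁ := hp₁.odd_of_ne_two hp₁2
  -- the multiplicity function of the level-`M` unit parts
  set cnt : ZMod M → ℕ := fun u ↦
    #(univ.filter fun i : Fin R ↦ m / m.gcd (α i).val = M ∧ ((((α i).val / (m / M)) : ℕ) : ZMod M) = u) with hcnt
  set T : ZMod M → ℂ := fun u ↦ (cnt u : ℂ) with hT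
  have hTnat : ∀ u, ∃ k : ℕ, T u = k := fun u ↦ ⟨cnt u, rfl⟩
  have hnotev : ¬ ∀ u, T (-u) = T u := by
    intro hev
    obtain ⟨v, hv⟩ := hne
    apply hv
    have := hev v
    simp only [hT, Nat.cast_inj] at this
    exact this
  have hspec : ∀ i, IsUnit ((((α i).val / (m / (m / m.gcd (α i).val)) : ℕ) : ZMod (m / m.gcd (α i).val))) ∧
      ((m / (m / m.gcd (α i).val) : ℕ) : ZMod m) *
        ((ZMod.val ((((α i).val / (m / (m / m.gcd (α i).val)) : ℕ) : ZMod (m / m.gcd (α i).val))) : ℕ) : ZMod m)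
          = α i :=
    fun i ↦ unitPart_spec (α i)
  have hcastM : ∀ (L : ℕ) (_ : L = M) (y : ZMod m),
      (ZMod.cast ((((y.val / (m / L)) : ℕ) : ZMod L)) : ZMod M) = (((y.val / (m / M)) : ℕ) : ZMod M) := by
    intro L hL y; subst hL; exact ZMod.cast_id _ _
  have hcast : ∀ (L M' : ℕ) (_ : L = M') (hMM' : M ∣ M') (y : ZMod m),
      (ZMod.cast ((((y.val / (m / L)) : ℕ) : ZMod L)) : ZMod M) =
        ZMod.castHom hMM' (ZMod M) ((((y.val / (m / M')) : ℕ) : ZMod M')) := by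
    intro L M' hL hMM' y; subst hL; rfl
  have hTu : ∀ u, ¬ IsUnit u → T u = 0 := by
    intro u hu
    simp only [hT, Nat.cast_eq_zero, hcnt, Finset.card_eq_zero, Finset.filter_eq_empty_iff]
    intro i _ hi
    apply hu
    have hdvd : M ∣ m / m.gcd (α i).val := by rw [hi.1]
    rw [← hi.2, ← hcastM _ hi.1 (α i)]
    exact ((hspec i).1).map (ZMod.castHom hdvd (ZMod M))
  set I : Finset (Fin R) := univ.filter fun i : Fin R ↦ m / m.gcd (α i).val = M with hI
  have hsupp_img : (univ.filter fun u : ZMod M ↦ T u ≠ 0) =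
      I.image fun i ↦ ((((α i).val / (m / M)) : ℕ) : ZMod M) := by
    ext u
    rw [mem_filter, mem_image]
    simp only [mem_univ, true_and, hT, Nat.cast_ne_zero, hcnt]
    rw [Finset.card_ne_zero]
    constructor
    · rintro ⟨i, hi⟩
      rw [mem_filter] at hi
      exact ⟨i, by rw [hI, mem_filter]; exact ⟨mem_univ _, hi.2.1⟩, hi.2.2⟩
    · rintro ⟨i, hi, hiu⟩
      rw [hI, mem_filter] at hi
      exact ⟨i, by rw [mem_filter]; exact ⟨mem_univ _, hi.2, hiu⟩⟩
  have hsuppR : #(univ.filter fun u : ZMod M ↦ T u ≠ 0) ≤ R := by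
    rw [hsupp_img]
    exact card_image_le.trans ((card_le_univ I).trans (by rw [Fintype.card_fin]))
  -- every prime of `m` (hence of `M`) is at least `p₁ ≥ 5`
  have hMmin : ∀ p ∈ M.primeFactors, p₁ ≤ p := fun p hp ↦ hmin p (Nat.mem_primeFactors.mpr
    ⟨Nat.prime_of_mem_primeFactors hp, (Nat.dvd_of_mem_primeFactors hp).trans hMm, hm0⟩)
  have hM5 : ∀ p ∈ M.primeFactors, 5 ≤ p := fun p hp ↦ hp₁5.trans (hMmin p hp)
  haveI : ∀ i, NeZero (m / m.gcd (α i).val) := fun i ↦ ⟨(level_pos (α i)).ne'⟩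
  -- Aoki's criterion at conductor `M`: `T` is orthogonal to the odd primitive characters mod `M`
  have hTodd : ∀ χ : DirichletCharacter ℂ M, χ.Odd → χ.IsPrimitive → ∑ u : ZMod M, T u * χ u = 0 := by
    intro χ hχ hprim
    have key := h.aoki_criterion hMm hχ hprim (fun i ↦ m / m.gcd (α i).val) (fun i ↦ level_dvd (α i))
      (fun i ↦ ((((α i).val / (m / (m / m.gcd (α i).val)) : ℕ) : ZMod (m / m.gcd (α i).val))))
      (fun i ↦ (hspec i).1) (fun i ↦ (hspec i).2.symm)
    have hone : (∏ p ∈ M.primeFactors, (1 - χ p)) = 1 := by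
      refine Finset.prod_eq_one fun p hp ↦ ?_
      have hnu : ¬ IsUnit ((p : ℕ) : ZMod M) := by
        rw [ZMod.isUnit_iff_coprime]
        exact fun hc ↦ (Nat.prime_of_mem_primeFactors hp).one_lt.ne'
          (Nat.Coprime.eq_one_of_dvd hc (Nat.dvd_of_mem_primeFactors hp))
      rw [χ.map_nonunit hnu, sub_zero]
    have hA : (fun L : ℕ ↦ ((m.totient : ℂ) / (L.totient : ℂ)) * ∏ p ∈ L.primeFactors, (1 - χ p)) M ≠ 0 := by
      show ((m.totient : ℂ) / (M.totient : ℂ)) * ∏ p ∈ M.primeFactors, (1 - χ p) ≠ 0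
      rw [hone, mul_one]
      exact div_ne_zero (by exact_mod_cast (Nat.totient_pos.mpr (NeZero.pos m)).ne')
        (by exact_mod_cast (Nat.totient_pos.mpr (NeZero.pos M)).ne')
    have key' := sum_level_eq_zero_of_criterion χ hχ (fun i ↦ m / m.gcd (α i).val)
      (fun i ↦ (level_pos (α i)).ne')
      (fun i ↦ ((((α i).val / (m / (m / m.gcd (α i).val)) : ℕ) : ZMod (m / m.gcd (α i).val))))
      (fun L : ℕ ↦ ((m.totient : ℂ) / (L.totient : ℂ)) * ∏ p ∈ L.primeFactors, (1 - χ p)) hA key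
      (fun i ↦ ((((α i).val / (m / M)) : ℕ) : ZMod M)) (fun i hi ↦ hcastM _ hi (α i))
      (fun L i ↦ ((((α i).val / (m / L)) : ℕ) : ZMod L)) (fun L hML i hiL ↦ hcast _ L hiL hML (α i))
      (fun L ⟨i, hiL⟩ hML hLM u ↦ hIH L (hiL ▸ level_dvd (α i)) hML hLM u)
    rw [sum_comp_eq_sum_card_mul (univ.filter fun i : Fin R ↦ m / m.gcd (α i).val = M)
      (fun i ↦ ((((α i).val / (m / M)) : ℕ) : ZMod M)) (fun u ↦ (χ u)⁻¹)] at key'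
    simp only [Finset.filter_filter] at key'
    have hconj : starRingEnd ℂ (∑ u : ZMod M, T u * χ u) = 0 := by
      rw [map_sum, ← key']
      refine Finset.sum_congr rfl fun u _ ↦ ?_
      rw [map_mul, hT, Complex.conj_natCast, char_inv_eq_conj]
    have := congrArg (starRingEnd ℂ) hconj
    rwa [starRingEnd_self_apply, map_zero] at this
  -- the refined counting leaves a prime `p ∈ {p₁, p₁ + 2}` of `M` without room
  have hbad : ∃ p ∈ M.primeFactors, ¬ (#(univ.filter fun u : ZMod M ↦ T u ≠ 0) + 1 < p ∨
      (p = M.minFac ∧ p * p ∣ M ∧ #(univ.filter fun u : ZMod M ↦ T u ≠ 0) < p)) := by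
    by_contra hgood
    push Not at hgood
    exact hnotev (even_of_oddNull' hM5 T hTu hTodd fun p hp ↦ by
      have := hgood p hp; tauto)
  obtain ⟨p, hpmem, hpbad⟩ := hbad
  have hp : p.Prime := Nat.prime_of_mem_primeFactors hpmem
  have hpM : p ∣ M := Nat.dvd_of_mem_primeFactors hpmem
  have hpmin : p₁ ≤ p := hMmin p hpmem
  have hple : p ≤ #(univ.filter fun u : ZMod M ↦ T u ≠ 0) + 1 := by
    by_contra hlt; exact hpbad (Or.inl (by omega))
  have hpR : p ≤ p₁ + 2 := by omega
  have hpodd : p ≠ p₁ + 1 := by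
    intro he
    have h2 : 2 ∣ p := by obtain ⟨k, hk⟩ := hp₁odd; exact ⟨k + 1, by omega⟩
    rcases hp.eq_one_or_self_of_dvd 2 h2 with h | h <;> omega
  -- sum of the multiplicities over the support is at most `R`
  have hsum_cnt : ∑ u ∈ univ.filter (fun u : ZMod M ↦ T u ≠ 0), cnt u ≤ R := by
    have hfib : ∑ u : ZMod M, cnt u = #I := by
      rw [hI, Finset.card_eq_sum_ones, ← Finset.sum_fiberwise_of_maps_to (t := univ)
        (g := fun i : Fin R ↦ ((((α i).val / (m / M)) : ℕ) : ZMod M)) (fun i _ ↦ mem_univ _)]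
      refine Finset.sum_congr rfl fun u _ ↦ ?_
      rw [hcnt, Finset.sum_const, smul_eq_mul, mul_one, Finset.filter_filter]
    calc ∑ u ∈ univ.filter (fun u : ZMod M ↦ T u ≠ 0), cnt u ≤ ∑ u : ZMod M, cnt u :=
          Finset.sum_le_sum_of_subset (filter_subset _ _)
      _ = #I := hfib
      _ ≤ R := (card_le_univ I).trans (by rw [Fintype.card_fin])
  have hge1 : ∀ u ∈ univ.filter (fun u : ZMod M ↦ T u ≠ 0), 1 ≤ cnt u := by
    intro u hu
    rw [mem_filter] at hu
    have : cnt u ≠ 0 := fun h0 ↦ hu.2 (by simp only [hT, h0, Nat.cast_zero])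
    omega
  rcases (show p = p₁ ∨ p = p₁ + 2 by omega) with rfl | rfl
  · /- `p = p₁`: `M = p₁ n`, `p₁ ∤ n`, `n > 1`, primes of `n` ≥ `p₁ + 3`, and the ℕ-valued dichotomy -/
    have hsqM : ¬ p * p ∣ M := fun h' ↦ hsq (h'.trans hMm)
    obtain ⟨n, rfl⟩ := hpM
    have hn0 : n ≠ 0 := fun h0 ↦ hM0 (by rw [h0, mul_zero])
    haveI : NeZero n := ⟨hn0⟩
    have hpn : ¬ p ∣ n := fun hd ↦ hsqM (mul_dvd_mul_left p hd)
    have hc : Nat.Coprime p n := (Nat.Prime.coprime_iff_not_dvd hp).mpr hpn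
    have hn1 : n ≠ 1 := by
      intro hn1
      subst hn1
      exact hnotev (even_of_oddNull_prime (by rw [mul_one]; exact hp) T hTu hTodd)
    have hn5 : ∀ p' ∈ n.primeFactors, 5 ≤ p' := fun p' hp' ↦ hM5 p' (by
      rw [Nat.primeFactors_mul hp.ne_zero hn0]; exact mem_union_right _ hp')
    have hnroom : ∀ p' ∈ n.primeFactors, p + 3 ≤ p' := by
      intro p' hp'
      have hp'P := Nat.prime_of_mem_primeFactors hp'
      have hp'n := Nat.dvd_of_mem_primeFactors hp'
      have hge := hMmin p' (by rw [Nat.primeFactors_mul hp.ne_zero hn0]; exact mem_union_right _ hp')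
      have hne0 : p' ≠ p := fun he ↦ hpn (he ▸ hp'n)
      have hne1 : p' ≠ p + 1 := by
        intro he
        have h2 : 2 ∣ p' := by obtain ⟨k, hk⟩ := hp₁odd; exact ⟨k + 1, by omega⟩
        rcases hp'P.eq_one_or_self_of_dvd 2 h2 with h' | h' <;> omega
      have hne2 : p' ≠ p + 2 := fun he ↦ htwin ((mul_dvd_mul_left p (he ▸ hp'n)).trans hMm)
      omega
    have hroom : ∀ p' ∈ n.primeFactors, #(univ.filter fun u : ZMod (p * n) ↦ T u ≠ 0) + 1 < p' := by
      intro p' hp'; have := hnroom p' hp'; omega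
    rcases stub_fibre_of_boundary_nat p n hp hp₁5 hpn hn5 hc T hTnat hTu hTodd hroom with hev | ⟨b, hbu, hfib⟩
    · exact absurd hev hnotev
    refine ⟨n, hc, rfl, by omega, b, hbu, fun y ↦ ?_⟩
    have hne0 : cnt ((ZMod.chineseRemainder hc).symm ((y : ZMod p), b)) ≠ 0 := by
      have := hfib y
      simpa only [hT, Nat.cast_ne_zero] using this
    obtain ⟨i, hi⟩ := Finset.card_ne_zero.mp hne0
    rw [mem_filter] at hi
    exact ⟨i, hi.2.1, hi.2.2⟩
  · /- the twin `p₀ = p₁ + 2`: `R` distinct unit entries at level `M = p₀ n`; the boundary case of Aoki's Thm A -/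
    exfalso
    set p₀ := p₁ + 2 with hp₀def
    have hp₀ : p₀.Prime := hp
    have hp₀5 : 5 ≤ p₀ := by omega
    have hSR : #(univ.filter fun u : ZMod M ↦ T u ≠ 0) = R := le_antisymm hsuppR (by omega)
    have hcop : Nat.Coprime p₁ p₀ := (Nat.coprime_primes hp₁ hp₀).mpr (by omega)
    have hp₁M : ¬ p₁ ∣ M := fun h1 ↦ htwin ((Nat.Coprime.mul_dvd_of_dvd_of_dvd hcop h1 hpM).trans hMm)
    have hminFac : p₀ = M.minFac := by
      have hM1 : M ≠ 1 := fun h1' ↦ by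
        rw [h1'] at hpM; exact absurd (Nat.le_of_dvd one_pos hpM) (by omega)
      have h1 : M.minFac ≤ p₀ := Nat.minFac_le_of_dvd (by omega) hpM
      have hmf : M.minFac.Prime := Nat.minFac_prime hM1
      have h2 : M.minFac ∈ M.primeFactors := Nat.mem_primeFactors.mpr ⟨hmf, Nat.minFac_dvd M, hM0⟩
      have h3 := hMmin _ h2
      have h4 : M.minFac ≠ p₁ := fun he ↦ hp₁M (he ▸ Nat.minFac_dvd M)
      have h6 : M.minFac ≠ p₁ + 1 := by
        intro he
        have h2' : 2 ∣ M.minFac := by obtain ⟨k, hk⟩ := hp₁odd; exact ⟨k + 1, by omega⟩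
        rcases hmf.eq_one_or_self_of_dvd 2 h2' with h' | h' <;> omega
      omega
    have hsq₀ : ¬ p₀ * p₀ ∣ M := fun hsq' ↦ hpbad (Or.inr ⟨hminFac, hsq', by omega⟩)
    obtain ⟨n, rfl⟩ := hpM
    have hn0 : n ≠ 0 := fun h0 ↦ hM0 (by rw [h0, mul_zero])
    haveI : NeZero n := ⟨hn0⟩
    haveI : NeZero p₀ := ⟨hp₀.ne_zero⟩
    have hp₀n : ¬ p₀ ∣ n := fun hd ↦ hsq₀ (mul_dvd_mul_left p₀ hd)
    have hn5 : ∀ p' ∈ n.primeFactors, 5 ≤ p' := fun p' hp' ↦ hM5 p' (by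
      rw [Nat.primeFactors_mul hp₀.ne_zero hn0]; exact mem_union_right _ hp')
    by_cases hn1 : n = 1
    · subst hn1
      exact hnotev (even_of_oddNull_prime (by rw [mul_one]; exact hp₀) T hTu hTodd)
    have hnbig : ∀ p' ∈ n.primeFactors, p₀ + 1 < p' := by
      intro p' hp'
      have hp'P := Nat.prime_of_mem_primeFactors hp'
      have hp'n := Nat.dvd_of_mem_primeFactors hp'
      have hge := hMmin p' (by rw [Nat.primeFactors_mul hp₀.ne_zero hn0]; exact mem_union_right _ hp')
      have hne0 : p' ≠ p₁ := fun he ↦ hp₁M (he ▸ hp'n.trans (dvd_mul_left n p₀))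
      have hne2 : p' ≠ p₀ := fun he ↦ hp₀n (he ▸ hp'n)
      have h2' : ∀ k, p' = p₁ + 2 * k + 1 → False := by
        intro k he
        have h2 : 2 ∣ p' := by obtain ⟨k', hk'⟩ := hp₁odd; exact ⟨k' + k + 1, by omega⟩
        rcases hp'P.eq_one_or_self_of_dvd 2 h2 with h' | h' <;> omega
      have hne1 : p' ≠ p₁ + 1 := fun he ↦ h2' 0 (by omega)
      have hne3 : p' ≠ p₁ + 3 := fun he ↦ h2' 1 (by omega)
      omega
    have hroom : ∀ p' ∈ n.primeFactors, #(univ.filter fun u : ZMod (p₀ * n) ↦ T u ≠ 0) + 1 < p' := by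
      intro p' hp'; have := hnbig p' hp'; omega
    have hc : Nat.Coprime p₀ n := (Nat.Prime.coprime_iff_not_dvd hp₀).mpr hp₀n
    -- `T` takes only the values `0, 1`
    have h01 : ∀ u, T u = 0 ∨ T u = 1 := by
      have hones : ∑ u ∈ univ.filter (fun u : ZMod (p₀ * n) ↦ T u ≠ 0), (1 : ℕ) = R := by
        rw [Finset.sum_const, smul_eq_mul, mul_one, hSR]
      have heq : ∀ u ∈ univ.filter (fun u : ZMod (p₀ * n) ↦ T u ≠ 0), cnt u = 1 := by
        have hle2 : ∑ u ∈ univ.filter (fun u : ZMod (p₀ * n) ↦ T u ≠ 0), cnt u ≤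
            ∑ u ∈ univ.filter (fun u : ZMod (p₀ * n) ↦ T u ≠ 0), (1 : ℕ) := by rw [hones]; exact hsum_cnt
        have := (Finset.sum_eq_sum_iff_of_le hge1).mp (le_antisymm (Finset.sum_le_sum hge1) hle2)
        exact fun u hu ↦ (this u hu).symm
      intro u
      by_cases hu : T u = 0
      · exact Or.inl hu
      · right
        have h1 := heq u (by rw [mem_filter]; exact ⟨mem_univ _, hu⟩)
        simp only [hT, h1, Nat.cast_one]
    rcases even_or_fibre_of_boundary hp₀ hp₀5 hp₀n hn5 hc T h01 hTu hTodd hroom with hev | ⟨b, hbu, hfib⟩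
    · exact hnotev hev
    -- the full fibre: all `R` entries have level `p₀ n` and `n`-residue `b`
    have hsupp_eq : (univ.filter fun u : ZMod (p₀ * n) ↦ T u ≠ 0) =
        (univ : Finset (ZMod p₀)ˣ).image fun y : (ZMod p₀)ˣ ↦ (ZMod.chineseRemainder hc).symm ((y : ZMod p₀), b) := by
      symm
      apply Finset.eq_of_subset_of_card_le
      · intro u hu
        obtain ⟨y, -, rfl⟩ := mem_image.mp hu
        rw [mem_filter]
        exact ⟨mem_univ _, by rw [hfib y]; exact one_ne_zero⟩
      · rw [hSR, Finset.card_image_of_injective, Finset.card_univ, ZMod.card_units_eq_totient,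
          Nat.totient_prime hp₀]
        · omega
        · intro y y' hyy
          have := congrArg (ZMod.chineseRemainder hc) hyy
          simp only [RingEquiv.apply_symm_apply, Prod.mk.injEq] at this
          exact Units.ext this.1
    have hres : ∀ i : Fin R, m / m.gcd (α i).val = p₀ * n ∧
        ZMod.castHom (dvd_mul_left n p₀) (ZMod n) ((((α i).val / (m / (p₀ * n))) : ℕ) : ZMod (p₀ * n)) = b := by
      have hIcard : #I = R := by
        refine le_antisymm ((card_le_univ I).trans (by rw [Fintype.card_fin])) ?_
        calc R = #(univ.filter fun u : ZMod (p₀ * n) ↦ T u ≠ 0) := hSR.symm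
          _ = #(I.image fun i ↦ ((((α i).val / (m / (p₀ * n))) : ℕ) : ZMod (p₀ * n))) := by rw [hsupp_img]
          _ ≤ #I := card_image_le
      have hIuniv : I = univ := Finset.eq_univ_of_card I (by rw [hIcard, Fintype.card_fin])
      intro i
      have hiI : i ∈ I := hIuniv ▸ mem_univ i
      have hlev : m / m.gcd (α i).val = p₀ * n := (mem_filter.mp hiI).2
      refine ⟨hlev, ?_⟩
      have hmem : ((((α i).val / (m / (p₀ * n))) : ℕ) : ZMod (p₀ * n)) ∈
          univ.filter fun u : ZMod (p₀ * n) ↦ T u ≠ 0 := by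
        rw [hsupp_img]
        exact mem_image_of_mem _ hiI
      rw [hsupp_eq] at hmem
      obtain ⟨y, -, hy⟩ := mem_image.mp hmem
      rw [← hy, (castHom_crt_symm hc _ b).2]
    -- Aoki's criterion at `f = n`: `χ(p₀) = 1` for every odd primitive `χ` mod `n`
    have hnm : n ∣ m := (dvd_mul_left n p₀).trans hMm
    have hall : ∀ χ : DirichletCharacter ℂ n, χ.Odd → χ.IsPrimitive → χ ((p₀ : ℕ) : ZMod n) = 1 := by
      intro χ hχ hprim
      have key := h.aoki_criterion hnm hχ hprim (fun i ↦ m / m.gcd (α i).val) (fun i ↦ level_dvd (α i))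
        (fun i ↦ ((((α i).val / (m / (m / m.gcd (α i).val)) : ℕ) : ZMod (m / m.gcd (α i).val))))
        (fun i ↦ (hspec i).1) (fun i ↦ (hspec i).2.symm)
      have hcastn : ∀ (L : ℕ) (_ : L = p₀ * n) (y : ZMod m),
          (ZMod.cast ((((y.val / (m / L)) : ℕ) : ZMod L)) : ZMod n) =
            ZMod.castHom (dvd_mul_left n p₀) (ZMod n) ((((y.val / (m / (p₀ * n))) : ℕ) : ZMod (p₀ * n))) := by
        intro L hL y; subst hL; rfl
      have hprod : (∏ p ∈ (p₀ * n).primeFactors, (1 - χ p)) = 1 - χ ((p₀ : ℕ) : ZMod n) := by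
        rw [Nat.primeFactors_mul hp₀.ne_zero hn0, hp₀.primeFactors, Finset.prod_union, Finset.prod_singleton]
        · have hone : (∏ p ∈ n.primeFactors, (1 - χ p)) = 1 := by
            refine Finset.prod_eq_one fun p hp ↦ ?_
            have hnu : ¬ IsUnit ((p : ℕ) : ZMod n) := by
              rw [ZMod.isUnit_iff_coprime]
              exact fun hc' ↦ (Nat.prime_of_mem_primeFactors hp).one_lt.ne'
                (Nat.Coprime.eq_one_of_dvd hc' (Nat.dvd_of_mem_primeFactors hp))
            rw [χ.map_nonunit hnu, sub_zero]
          rw [hone, mul_one]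
        · rw [Finset.disjoint_singleton_left]
          exact fun hmem ↦ hp₀n (Nat.dvd_of_mem_primeFactors hmem)
      have hterm : ∀ i : Fin R, (if n ∣ m / m.gcd (α i).val then
          ((m.totient : ℂ) / ((m / m.gcd (α i).val).totient : ℂ)) *
            (∏ p ∈ (m / m.gcd (α i).val).primeFactors, (1 - χ p)) *
            (χ (ZMod.cast ((((α i).val / (m / (m / m.gcd (α i).val))) : ℕ) : ZMod (m / m.gcd (α i).val)) : ZMod n))⁻¹
          else 0) =
          ((m.totient : ℂ) / ((p₀ * n).totient : ℂ)) * (1 - χ ((p₀ : ℕ) : ZMod n)) * (χ b)⁻¹ := by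
        intro i
        obtain ⟨hlev, hb⟩ := hres i
        rw [hcastn _ hlev (α i), hb, if_pos (hlev ▸ dvd_mul_left n p₀), hlev, hprod]
      rw [Finset.sum_congr rfl fun i _ ↦ hterm i, Finset.sum_const, Finset.card_univ, Fintype.card_fin,
        nsmul_eq_mul] at key
      have hRne : (R : ℂ) ≠ 0 := by exact_mod_cast (show R ≠ 0 by omega)
      have hc₀ : (m.totient : ℂ) / ((p₀ * n).totient : ℂ) ≠ 0 :=
        div_ne_zero (by exact_mod_cast (Nat.totient_pos.mpr (NeZero.pos m)).ne')
          (by exact_mod_cast (Nat.totient_pos.mpr (NeZero.pos (p₀ * n))).ne')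
      have hχb0 : χ b ≠ 0 := by
        rw [← hbu.unit_spec]
        intro h0
        have := DirichletCharacter.unit_norm_eq_one χ hbu.unit
        rw [h0, norm_zero] at this
        exact zero_ne_one this
      have hχb : (χ b)⁻¹ ≠ 0 := inv_ne_zero hχb0
      rcases mul_eq_zero.mp key with h0 | h0
      · exact (hRne h0).elim
      · rcases mul_eq_zero.mp h0 with h0 | h0
        · rcases mul_eq_zero.mp h0 with h0 | h0
          · exact (hc₀ h0).elim
          · exact (sub_eq_zero.mp h0).symm
        · exact (hχb h0).elim
    have hnodd : Odd n := by
      rw [Nat.odd_iff]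
      by_contra h2
      have h2n : 2 ∣ n := Nat.dvd_of_mod_eq_zero (by omega)
      have := hn5 2 (Nat.mem_primeFactors.mpr ⟨Nat.prime_two, h2n, hn0⟩)
      omega
    obtain ⟨χ, hχo, hχp, hχne⟩ :=
      exists_odd_isPrimitive_apply_natCast_ne_one (n := n) (p₀ := p₀) hp₀.two_le hn1 hnodd hnbig hc
    exact hχne (hall χ hχo hχp)

end TopLevelGeneral

/-- **GP-L2a `stub_fibre_of_top_level_general`** (registered form of `fibre_of_top_level_general`). [cite: Aoki1983, Thm. A′ (§7), Prop. 2.2, Prop. 6.4] -/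
theorem stub_fibre_of_top_level_general : ∀ (p₁ : ℕ), p₁.Prime → 5 ≤ p₁ → ∀ {m : ℕ} [NeZero m] {α : Fin (p₁ + 1) → ZMod m}, (∀ q ∈ m.primeFactors, p₁ ≤ q) → ¬ p₁ * p₁ ∣ m → ¬ p₁ * (p₁ + 2) ∣ m → FermatCharacter.IsHodge α → ∀ {M : ℕ}, M ∣ m → (∃ v : ZMod M, #(univ.filter fun i : Fin (p₁ + 1) ↦ m / m.gcd (α i).val = M ∧ ((((α i).val / (m / M)) : ℕ) : ZMod M) = -v) ≠ #(univ.filter fun i : Fin (p₁ + 1) ↦ m / m.gcd (α i).val = M ∧ ((((α i).val / (m / M)) : ℕ) : ZMod M) = v)) → (∀ M' : ℕ, M' ∣ m → M ∣ M' → M' ≠ M → ∀ u : ZMod M', #(univ.filter fun i : Fin (p₁ + 1) ↦ m / m.gcd (α i).val = M' ∧ ((((α i).val / (m / M')) : ℕ) : ZMod M') = -u) = #(univ.filter fun i : Fin (p₁ + 1) ↦ m / m.gcd (α i).val = M' ∧ ((((α i).val / (m / M')) : ℕ) : ZMod M') = u)) → ∃ (n : ℕ) (hc : Nat.Coprime p₁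 n), M = p₁ * n ∧ 1 < n ∧ ∃ b : ZMod n, IsUnit b ∧ ∀ y : (ZMod p₁)ˣ, ∃ i : Fin (p₁ + 1), m / m.gcd (α i).val = p₁ * n ∧ ((((α i).val / (m / (p₁ * n))) : ℕ) : ZMod (p₁ * n)) = (ZMod.chineseRemainder hc).symm ((y : ZMod p₁), b) :=
  fun _ hp₁ hp₁5 _ _ _ hmin hsq htwin h _ hMm hne hIH ↦ fibre_of_top_level_general hp₁ hp₁5 rfl hmin hsq htwin h hMm hne hIH


end PairedNull

end Summit.HodgeConjecture.HodgeConjecture.Theorems.CancelByAnyClaimLattice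

end
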